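import Summits.HodgeConjecture.CorCM.MumfordTateRankTypeTwoFourfoldLefschetz
import Summits.HodgeConjecture.CorCM.MumfordTateRankTypeTwoMinimal
import Summits.HodgeConjecture.CorCM.MumfordTateRankTypeOneRelDimTwo
import Summits.HodgeConjecture.CorCM.MumfordTateRankTimesRealMultiplicationCells
import Summits.HodgeConjecture.CorCM.MumfordTateRankTypeIVTimesCMCurveRigid
import Summits.HodgeConjecture.CorCM.MumfordTateRankSemisimpleTimesCM
import Summits.HodgeConjecture.CorCM.MumfordTateRankTimesNonCMCurve
import Summits.HodgeConjecture.CorCM.MumfordTateRankAtMostThree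
import Summits.HodgeConjecture.CorCM.MumfordTateRankProductsOfCurves
import Literature.AlgebraicGeometry.HodgeTheory.RealMultiplicationHodgeGroupEqLefschetz
import Literature.AlgebraicGeometry.Pohlmann1968.SimpleCMAbelianVarietyHazamaCriterion
import HarnessLib

/-!
# Elliptic curve × SIMPLE abelian FOURFOLD — the rows of the partition {1,4} that the tree decides: quaternion multiplication over `ℚ`
# (`{8, 10, 12, 14}`), over a real quadratic field (`{8, 10}`), real multiplication by a quartic (`{14, 16}`) or a quadratic (`{22, 24}`) field,
# Ribet type `(3,1)` (`{17, 18, 20}`), CM fourfold × non-CM curve (`{7, 8}`) (Moonen–Zarhin 1995/1999; Murty; BGK)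

COR-CM (cell `pub-hodgecm2`, seat `b27` gen 50, count-neutral Mumford–Tate-rank ladder; theorems only, no definition, no named fact;
UNCONDITIONAL — nothing here uses or asserts HC_CM).  Notation `t(X) = dim MT(H¹X)`.  The partition {1,4} is the only partition of a non-simple
fivefold not covered by `CorCM/MumfordTateRankNonSimpleFivefolds`; this file records the rows where `t(F)` of the simple fourfold `F` is known on the
ladder AND a product engine applies:
* `End⁰F` a quaternion algebra over `ℚ` (`t(F) = 7` definite / `11` indefinite, `CorCM/MumfordTateRankTypeTwoFourfoldLefschetz`): centre `ℚ` ⟹ no factor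
  of type IV ⟹ a CM curve adds `1` (`CorCM/MumfordTateRankSemisimpleTimesCM`), a non-CM curve adds `3` (Lemma (3.4)): **`{8, 10, 12, 14}`**;
* `End⁰F` a quaternion algebra over a real quadratic field (type II(2), `t(F) = 7`): **`t(E × F) = t(E) + 6 ∈ {8, 10}`**;
* `End⁰F` a totally real quartic field (Murty `r = 1`, `t(F) = 13`): **`t(E × F) = t(E) + 12 ∈ {14, 16}`**;
* `End⁰F` a real quadratic field (type I(2) with `m = 2`, `t(F) = 21`): **`{22, 24}`**;
* `F` of Ribet type `(3,1)` (`t(F) = 17`): **`20`** (non-CM curve), **`18`** (CM curve of another field), **`17`** (CM curve carrying `√−D`);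
* `F` of CM type (`t(F) ∈ {4, 5}`) and `E` non-CM: **`t = t(F) + 3 ∈ {7, 8}`**.
Not decided here: `End⁰F = ℚ` (Mumford's fourfolds), Weil type `(2,2)`, CM quartic `End⁰F` of type IV, CM fourfold × CM curve.

## References
* [MoonenZarhin1999LowDim] B. Moonen, Yu. G. Zarhin, Math. Ann. 315 (1999), §2 (2.2)–(2.4), §3 (3.1), Lemma (3.4), Prop. (3.8) [corpus: paper:arxiv-math_9901113
  pp. 5–7]. [cite: MoonenZarhin1999LowDim, §3 (3.4) and (3.8)]
* [MoonenZarhin1995Duke] B. Moonen, Yu. G. Zarhin, *Hodge classes and Tate classes on simple abelian fourfolds*, Duke Math. J. 77 (1995), Table 1.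
  [cite: MoonenZarhin1995Duke, Type I(2)]
* [Ribet1983] K. A. Ribet, Amer. J. Math. 105 (1983), Thm. 3. [cite: Ribet1983, Thm. 3]
* [BanaszakGajdaKrason2006] G. Banaszak, W. Gajda, P. Krasoń, (7.22), Thm. 7.34. [cite: BanaszakGajdaKrason2006, Thm. 7.34]
-/

noncomputable section

open CategoryTheory CategoryTheory.Limits Module NumberField

namespace Summit.HodgeConjecture.CorCM

open Literature.AlgebraicGeometry.Motives
open Literature.AlgebraicGeometry.Motives.AbelianVariety
open Literature.AlgebraicGeometry.Motives.HodgeStructure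
open Literature.AlgebraicGeometry.HodgeTheory
open Literature.AlgebraicGeometry.ComplexMultiplication
open Literature.AlgebraicGeometry.Milne1999 (IsOfCMType isOfCMType_iff_of_isIsogenous)
open Literature.AlgebraicGeometry.Pohlmann1968
open Literature.NumberTheory.Automorphic (IsQuaternionAlgebra IsTotallyDefinite)
open Literature.RingTheory.CentralSimple

variable [HodgeTensorFacts.{0, 0}] {X E F : AbelianVariety ℂ} {n : ℕ}

omit [HodgeTensorFacts.{0, 0}] in
/-- A simple fourfold and a curve have `Hom(F, E) = 0` (simple varieties of different dimensions). [cite: MumfordAV1970, §19 Cor. 2 of Thm. 1] -/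
private theorem hom_fourfold_curve_eq_zero (hFs : F.IsSimple) (hF4 : F.dim = 4) (hE1 : E.dim = 1) : ∀ u : F ⟶ E, u = 0 :=
  hom_eq_zero_of_isSimple_of_dim_ne hFs (isSimple_of_dim_le_one hE1.le) (by omega)

/-! ## §1 Quaternion multiplication over `ℚ` (types II, III with centre `ℚ`) -/

/-- **`E × F` for a simple fourfold `F` with `End⁰F` a quaternion algebra over `ℚ`: `t = t(F) + 1` for a CM curve, `t = t(F) + 3` for a non-CM
curve**, with `t(F) = 7` (definite) or `11` (indefinite); the centre of `End⁰F` is `ℚ`, so `F` has no factor of type IV and Moonen–Zarhin (3.2)(2)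
applies to the CM curve. [cite: MoonenZarhin1999LowDim, §3 (3.4) and (3.8)] [cite: BanaszakGajdaKrason2006, Thm. 7.34] -/
theorem mtRank_hodge_one_of_isIsogenous_curve_prod_quaternion_fourfold (hX : IsSmoothProjective n X.X) (hFs : F.IsSimple) (hF4 : F.dim = 4)
    [IsQuaternionAlgebra ℚ F.endAlgebra] (hE1 : E.dim = 1) (hXP : IsIsogenous X (E.prod F)) :
    haveI := BettiUniverse.finite hX 1
    (IsOfCMType E ∧ IsTotallyDefinite ℚ F.endAlgebra ∧ (BettiUniverse.hodge exists_isReal_hodgeModel_holds hX 1).mtRank = 8) ∨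
      (IsOfCMType E ∧ IsTotallyIndefinite ℚ F.endAlgebra ∧ (BettiUniverse.hodge exists_isReal_hodgeModel_holds hX 1).mtRank = 12) ∨
      (¬ IsOfCMType E ∧ IsTotallyDefinite ℚ F.endAlgebra ∧ (BettiUniverse.hodge exists_isReal_hodgeModel_holds hX 1).mtRank = 10) ∨
      (¬ IsOfCMType E ∧ IsTotallyIndefinite ℚ F.endAlgebra ∧ (BettiUniverse.hodge exists_isReal_hodgeModel_holds hX 1).mtRank = 14) := by
  haveI := BettiUniverse.finite hX 1
  have hF : IsSmoothProjective F.dim F.X := AbelianVariety.isSmoothProjective_holds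
  have hE : IsSmoothProjective E.dim E.X := AbelianVariety.isSmoothProjective_holds
  haveI := BettiUniverse.finite hF 1
  haveI := BettiUniverse.finite hE 1
  have hIV : HasNoTypeIVFactor F := hasNoTypeIVFactor_of_center_le_bot (le_of_eq (Algebra.IsCentral.center_eq_bot ℚ F.endAlgebra))
  have hF711 := mtRank_hodge_one_eq_seven_or_eleven_of_isSimple_quaternion_fourfold hF hFs hF4
  by_cases hcm : IsOfCMType E
  · have h2 := mtRank_hodge_one_eq_two_of_cm_curve hE1 hcm
    have h := mtRank_hodge_one_add_one_eq_add_of_isIsogenous_prod hX hF hE (by omega) (by omega) hIV hcm (hXP.trans (isIsogenous_prod_comm E F))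
    rcases hF711 with ⟨hdef, h7⟩ | ⟨hind, h11⟩
    · exact Or.inl ⟨hcm, hdef, by omega⟩
    · exact Or.inr (Or.inl ⟨hcm, hind, by omega⟩)
  · have h := mtRank_hodge_one_eq_add_three_of_isIsogenous_nonCMCurve_prod hX hF (by omega) hE1 hcm (hom_fourfold_curve_eq_zero hFs hF4 hE1) hXP
    rcases hF711 with ⟨hdef, h7⟩ | ⟨hind, h11⟩
    · exact Or.inr (Or.inr (Or.inl ⟨hcm, hdef, by omega⟩))
    · exact Or.inr (Or.inr (Or.inr ⟨hcm, hind, by omega⟩))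

/-- **`t(E × F) ∈ {8, 10, 12, 14}` for a simple fourfold with quaternion multiplication over `ℚ` and any elliptic curve.**
[cite: MoonenZarhin1999LowDim, §3 (3.4) and (3.8)] -/
theorem mtRank_hodge_one_mem_of_isIsogenous_curve_prod_quaternion_fourfold (hX : IsSmoothProjective n X.X) (hFs : F.IsSimple) (hF4 : F.dim = 4)
    [IsQuaternionAlgebra ℚ F.endAlgebra] (hE1 : E.dim = 1) (hXP : IsIsogenous X (E.prod F)) :
    haveI := BettiUniverse.finite hX 1
    (BettiUniverse.hodge exists_isReal_hodgeModel_holds hX 1).mtRank ∈ ({8, 10, 12, 14} : Finset ℕ) := by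
  simp only [Finset.mem_insert, Finset.mem_singleton]
  rcases mtRank_hodge_one_of_isIsogenous_curve_prod_quaternion_fourfold hX hFs hF4 hE1 hXP with
    ⟨-, -, h⟩ | ⟨-, -, h⟩ | ⟨-, -, h⟩ | ⟨-, -, h⟩ <;> omega

/-! ## §2 Quaternion multiplication over a real quadratic field (type II(2), `t(F) = 7`) -/

/-- **`t(E × F) = t(E) + 6` for a simple fourfold `F` with `End⁰F` a quaternion algebra over a real quadratic field `K`** (`dim F = 2[K:ℚ]`, the
minimal type II(2): `t(F) = 3[K:ℚ] + 1 = 7` by `CorCM/MumfordTateRankTypeTwoMinimal`; the product engine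
`mtRank_hodge_one_add_one_eq_add_of_isIsogenous_prod_isSimple_quaternion` of `CorCM/MumfordTateRankTimesRealMultiplication` applies to ANY second
factor with `Hom = 0`): `8` for a CM curve, `10` for a non-CM curve. [cite: MoonenZarhin1999LowDim, §2 (2.2) and §3 (3.4)]
[cite: BanaszakGajdaKrason2006, Thm. 7.34] -/
theorem mtRank_hodge_one_of_isIsogenous_curve_prod_quaternion_fourfold_real_quadratic (hX : IsSmoothProjective n X.X) (hFs : F.IsSimple)
    (hF4 : F.dim = 4) {K : Type} [Field K] [NumberField K] [IsTotallyReal K] [Algebra K F.endAlgebra] [IsScalarTower ℚ K F.endAlgebra]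
    [IsQuaternionAlgebra K F.endAlgebra] (hK2 : Module.finrank ℚ K = 2) (hE1 : E.dim = 1) (hXP : IsIsogenous X (E.prod F)) :
    haveI := BettiUniverse.finite hX 1
    (IsOfCMType E ∧ (BettiUniverse.hodge exists_isReal_hodgeModel_holds hX 1).mtRank = 8) ∨
      (¬ IsOfCMType E ∧ (BettiUniverse.hodge exists_isReal_hodgeModel_holds hX 1).mtRank = 10) := by
  haveI := BettiUniverse.finite hX 1
  have hF : IsSmoothProjective F.dim F.X := AbelianVariety.isSmoothProjective_holds
  have hE : IsSmoothProjective E.dim E.X := AbelianVariety.isSmoothProjective_holds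
  haveI := BettiUniverse.finite hF 1
  haveI := BettiUniverse.finite hE 1
  have hFK : F.dim = 2 * Module.finrank ℚ K := by rw [hF4, hK2]
  have h7 := (mtRank_hodge_one_of_isSimple_quaternion_of_dim_eq hF hFs hFK).1
  rw [hK2] at h7
  have h := mtRank_hodge_one_add_one_eq_add_of_isIsogenous_prod_isSimple_quaternion hX hE hF (by omega) hFs hFK
    (fun u => hom_eq_zero_of_isSimple_of_dim_ne (isSimple_of_dim_le_one hE1.le) hFs (by omega) u) hXP
  by_cases hcm : IsOfCMType E
  · have h2 := mtRank_hodge_one_eq_two_of_cm_curve hE1 hcm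
    exact Or.inl ⟨hcm, by omega⟩
  · have h4 := (curve_facts_of_not_isOfCMType hE1 hcm).1
    exact Or.inr ⟨hcm, by omega⟩

/-! ## §3 Real multiplication: quartic field (`t(F) = 13`) and quadratic field (`t(F) = 21`) -/

/-- **`t(E × F) = t(E) + 12` for a simple fourfold `F` whose endomorphism algebra is a totally real QUARTIC field** (`Hg(F) = R_{K/ℚ} SL₂`, `t(F) = 13`;
Murty's exchange engine `CorCM/MumfordTateRankTimesRealMultiplicationCells`): `14` for a CM curve, `16` for a non-CM curve.
[cite: MoonenZarhin1999LowDim, §2 (2.2) and §3 (3.4)] -/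
theorem mtRank_hodge_one_of_isIsogenous_curve_prod_fourfold_real_quartic (hX : IsSmoothProjective n X.X) (hFs : F.IsSimple) (hF4 : F.dim = 4)
    (hF : IsField F.endAlgebra) [IsTotallyReal (EndField F hF)] (hdeg : Module.finrank ℚ F.endAlgebra = 4) (hE1 : E.dim = 1)
    (hXP : IsIsogenous X (E.prod F)) :
    haveI := BettiUniverse.finite hX 1
    (IsOfCMType E ∧ (BettiUniverse.hodge exists_isReal_hodgeModel_holds hX 1).mtRank = 14) ∨
      (¬ IsOfCMType E ∧ (BettiUniverse.hodge exists_isReal_hodgeModel_holds hX 1).mtRank = 16) := by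
  haveI := BettiUniverse.finite hX 1
  have hE : IsSmoothProjective E.dim E.X := AbelianVariety.isSmoothProjective_holds
  haveI := BettiUniverse.finite hE 1
  have h := mtRank_hodge_one_eq_add_three_mul_dim_of_isIsogenous_prod_isTotallyReal hX hE (by omega) hF (by rw [hdeg, hF4])
    (fun u => hom_eq_zero_of_isSimple_of_dim_ne (isSimple_of_dim_le_one hE1.le) hFs (by omega) u) hXP
  rw [hF4] at h
  by_cases hcm : IsOfCMType E
  · have h2 := mtRank_hodge_one_eq_two_of_cm_curve hE1 hcm
    exact Or.inl ⟨hcm, by omega⟩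
  · have h4 := (curve_facts_of_not_isOfCMType hE1 hcm).1
    exact Or.inr ⟨hcm, by omega⟩

/-- **`E × F` for a simple fourfold `F` whose endomorphism algebra is a real QUADRATIC field** (type I(2) with relative dimension two,
`Hg(F) = R_{K/ℚ} Sp₄`, `t(F) = 21`): `22` for a CM curve (no factor of type IV: Moonen–Zarhin (3.2)(2)), `24` for a non-CM curve (Lemma (3.4)).
[cite: MoonenZarhin1995Duke, Type I(2)] [cite: MoonenZarhin1999LowDim, §3 (3.4) and (3.8)] -/
theorem mtRank_hodge_one_of_isIsogenous_curve_prod_fourfold_real_quadratic (hX : IsSmoothProjective n X.X) (hFs : F.IsSimple) (hF4 : F.dim = 4)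
    (hF : IsField F.endAlgebra) [IsTotallyReal (EndField F hF)] (hdeg : Module.finrank ℚ F.endAlgebra = 2) (hE1 : E.dim = 1)
    (hXP : IsIsogenous X (E.prod F)) :
    haveI := BettiUniverse.finite hX 1
    (IsOfCMType E ∧ (BettiUniverse.hodge exists_isReal_hodgeModel_holds hX 1).mtRank = 22) ∨
      (¬ IsOfCMType E ∧ (BettiUniverse.hodge exists_isReal_hodgeModel_holds hX 1).mtRank = 24) := by
  haveI := BettiUniverse.finite hX 1
  have hFsp : IsSmoothProjective F.dim F.X := AbelianVariety.isSmoothProjective_holds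
  have hE : IsSmoothProjective E.dim E.X := AbelianVariety.isSmoothProjective_holds
  haveI := BettiUniverse.finite hFsp 1
  haveI := BettiUniverse.finite hE 1
  have h21 := (mtRank_hodge_one_of_fourfold_real_quadratic_field hF hFsp hF4 hdeg).1
  by_cases hcm : IsOfCMType E
  · have h2 := mtRank_hodge_one_eq_two_of_cm_curve hE1 hcm
    have h := mtRank_hodge_one_add_one_eq_add_of_isIsogenous_prod hX hFsp hE (by omega) (by omega)
      (hasNoTypeIVFactor_of_isTotallyReal F hF) hcm (hXP.trans (isIsogenous_prod_comm E F))
    exact Or.inl ⟨hcm, by omega⟩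
  · have h := mtRank_hodge_one_eq_add_three_of_isIsogenous_nonCMCurve_prod hX hFsp (by omega) hE1 hcm (hom_fourfold_curve_eq_zero hFs hF4 hE1) hXP
    exact Or.inr ⟨hcm, by omega⟩

/-! ## §4 Ribet type `(3,1)` (`t(F) = 17`) -/

/-- **`E × F` for `F` of Ribet type `(3,1)`** (a fourfold with `End⁰F` a quadratic field that is not totally real, `φ ∘ φ = −D` with multiplicity one at
`± i√D`; `Hg(F) = U(3,1)`, `t(F) = 17`): **`20`** for a non-CM curve (Lemma (3.4)), **`18`** for a CM curve whose field does not map to `End⁰F`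
(Prop. (3.8)), **`17`** for a CM curve carrying `χ ∘ χ = −D` (codimension one, the Weil classes of `F × E²`). [cite: MoonenZarhin1999LowDim, Thm. 0.1 (4), §3 (3.4) and (3.8)]
[cite: Ribet1983, Thm. 3] -/
theorem mtRank_hodge_one_of_isIsogenous_curve_prod_ribetTypeOne_fourfold (hX : IsSmoothProjective n X.X) (hFs : F.IsSimple) (hF4 : F.dim = 4)
    (hF : IsField F.endAlgebra) (hnR : ¬ IsTotallyReal (EndField F hF)) (φ : F ⟶ F) {D : ℕ} (hD : 0 < D) (hφ : φ ≫ φ = -(D • 𝟙 F))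
    (hA2 : Module.finrank ℚ F.endAlgebra = 2)
    (h1 : eigenMultiplicity F φ (Complex.I * (Real.sqrt D : ℂ)) = 1 ∨ eigenMultiplicity F φ (-(Complex.I * (Real.sqrt D : ℂ))) = 1)
    (hE1 : E.dim = 1) (hXP : IsIsogenous X (E.prod F)) :
    haveI := BettiUniverse.finite hX 1
    (¬ IsOfCMType E → (BettiUniverse.hodge exists_isReal_hodgeModel_holds hX 1).mtRank = 20) ∧
      (IsOfCMType E → IsEmpty (E.endAlgebra →+* F.endAlgebra) → (BettiUniverse.hodge exists_isReal_hodgeModel_holds hX 1).mtRank = 18) ∧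
      ((∃ χ : E ⟶ E, χ ≫ χ = -(D • 𝟙 E)) → (BettiUniverse.hodge exists_isReal_hodgeModel_holds hX 1).mtRank = 17) := by
  haveI := BettiUniverse.finite hX 1
  have hFsp : IsSmoothProjective F.dim F.X := AbelianVariety.isSmoothProjective_holds
  haveI := BettiUniverse.finite hFsp 1
  have h17 := (mtRank_hodge_one_of_ribetTypeOne' hFsp hF hnR φ hD hφ hA2 h1 (by omega)).1
  have hsq : F.dim * F.dim = 16 := by rw [hF4]
  refine ⟨fun hcm => ?_, fun hcm hfor => ?_, fun hEχ => ?_⟩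
  · have h := mtRank_hodge_one_eq_add_three_of_isIsogenous_nonCMCurve_prod hX hFsp (by omega) hE1 hcm (hom_fourfold_curve_eq_zero hFs hF4 hE1) hXP
    omega
  · have h := mtRank_hodge_one_of_isIsogenous_cmCurve_prod_ribetTypeOne_of_isEmpty_ringHom hX hE1 hcm hF hnR φ hD hφ hA2 h1 (by omega) hfor hXP
    omega
  · have h := mtRank_hodge_one_eq_of_isIsogenous_ribetTypeOne_prod_cmCurve_of_exists_comp_self_eq_neg hX hF hnR φ hD hφ hA2 h1 (by omega) hE1
      hEχ hXP
    omega

/-! ## §5 A simple CM fourfold times a non-CM curve -/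

/-- A simple abelian fourfold of CM type has `t(F) ∈ {4, 5}` (`t ≤ dim F + 1`; Ribet's bound `4 · dim F ≤ 2^t` for the one-slot family of a
realisation of `F`). [cite: Ribet1980, §3 (3.5)] [cite: Gordon1999HodgeAVSurvey, 7.7 and 9.1] -/
theorem mtRank_hodge_one_mem_of_isSimple_cmFourfold {k : ℕ} (hFsp : IsSmoothProjective k F.X) (hFs : F.IsSimple) (hF4 : F.dim = 4)
    (hFcm : IsOfCMType F) :
    haveI := BettiUniverse.finite hFsp 1
    (BettiUniverse.hodge exists_isReal_hodgeModel_holds hFsp 1).mtRank = 4 ∨ (BettiUniverse.hodge exists_isReal_hodgeModel_holds hFsp 1).mtRank = 5 := by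
  classical
  haveI := BettiUniverse.finite hFsp 1
  have hle := mtRank_hodge_one_le_dim_add_one_of_isOfCMType hFsp (by omega) hFcm
  -- one-slot realisation and Ribet's bound
  obtain ⟨K, _, _, _, Φ, F', ι, θ, s₀, hA, hiso, hdeg, -, -⟩ := exists_realisation_mtRank_eq hFsp hFs (by omega) hFcm
  have hdimF' : F'.dim = F.dim := ((dim_eq_of_isIsogenous_holds hiso : F.dim = F'.dim)).symm
  have hs : F'.IsSimple := hFs.of_isIsogenous hiso
  have hXB : IsIsogenous F (⨁ fun j : Fin 1 => (fun _ : Fin 1 => F') (id j)) :=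
    hiso.trans (isIsogenous_biproduct_of_forall_eq (fun _ : Fin 1 => F') 0 (fun j => Subsingleton.elim _ _)).symm'
  have hR := four_mul_sum_dim_le_two_pow_mtRank_hodge_one (Φ' := fun _ : Fin 1 => Φ) (A' := fun _ : Fin 1 => F') (cls := id)
    (fun _ => hA) (fun _ => hs) (fun c c' hcc' => absurd (Subsingleton.elim c c') hcc') Function.surjective_id hFsp hXB
  simp only [Finset.univ_unique, Finset.sum_singleton, hdimF', hF4] at hR
  rw [hF4] at hle
  -- `16 ≤ 2^t`, `t ≤ 5`
  have h4 : 4 ≤ (BettiUniverse.hodge exists_isReal_hodgeModel_holds hFsp 1).mtRank := by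
    by_contra hlt
    push Not at hlt
    interval_cases (BettiUniverse.hodge exists_isReal_hodgeModel_holds hFsp 1).mtRank <;> simp at hR
  omega

/-- **Simple CM fourfold × non-CM curve: `t(E × F) = t(F) + 3 ∈ {7, 8}`** (Lemma (3.4), `Hom(F, E) = 0`). [cite: MoonenZarhin1999LowDim, §3 (3.4)] -/
theorem mtRank_hodge_one_mem_of_isIsogenous_nonCMCurve_prod_cmFourfold (hX : IsSmoothProjective n X.X) (hFs : F.IsSimple) (hF4 : F.dim = 4)
    (hFcm : IsOfCMType F) (hE1 : E.dim = 1) (hEcm : ¬ IsOfCMType E) (hXP : IsIsogenous X (E.prod F)) :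
    haveI := BettiUniverse.finite hX 1
    (BettiUniverse.hodge exists_isReal_hodgeModel_holds hX 1).mtRank = 7 ∨ (BettiUniverse.hodge exists_isReal_hodgeModel_holds hX 1).mtRank = 8 := by
  haveI := BettiUniverse.finite hX 1
  have hFsp : IsSmoothProjective F.dim F.X := AbelianVariety.isSmoothProjective_holds
  haveI := BettiUniverse.finite hFsp 1
  have h := mtRank_hodge_one_eq_add_three_of_isIsogenous_nonCMCurve_prod hX hFsp (by omega) hE1 hEcm (hom_fourfold_curve_eq_zero hFs hF4 hE1) hXP
  rcases mtRank_hodge_one_mem_of_isSimple_cmFourfold hFsp hFs hF4 hFcm with h45 | h45 <;> omega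

end Summit.HodgeConjecture.CorCM

end
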